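import Literature.AnabelianGeometry.AbsoluteAnabelian.DiagramMorphismsAutGroup
import Literature.AnabelianGeometry.AbsoluteAnabelian.DiagramMorphismPathIso
import HarnessLib

/-!
# [AbsTopIII] Def 3.5 (v) p.76: compatibility of an equivalence with families of homotopies is
# STABLE UNDER 2-ISOMORPHISM

S. Mochizuki, *Topics in absolute anabelian geometry III*, J. Math. Sci. Univ. Tokyo 22 (2015)
[MochizukiAbsTopIII2015], Definition 3.5 (v) p.76 (manuscript pages, lit key
`paper:url-5493eb38cbb7`), verbatim: "we shall say that an equivalence `Φ : 𝒟 ⥲ 𝒟'` is *compatible*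
with `ℋ`, `ℋ'` if `Φ_Γ⃗` induces a bijection between the boundary sets of `ℋ`, `ℋ'`, and, moreover,
the natural transformations that constitute `ℋ`, `ℋ'` are compatible with the natural transformations
that constitute `Φ`; in this situation, **one verifies immediately that if `Φ` is compatible with
`ℋ`, `ℋ'`, then so is any equivalence `Ψ : 𝒟 ⥲ 𝒟'` that is isomorphic to `Φ`**."

PROOF-ONLY companion (no definition, no instance, nothing restated) of `DiagramMorphisms.lean`
(abc-iut-L4-t2: `OneMorphism.CompatibleWith`, `TwoMorphism`, `OneMorphism.Isomorphic`,
`SelfEquivalence.Isomorphic`, `Aut`), `DiagramMorphismPathIso.lean` (abc-iut-f-102: the path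
isomorphisms `Φ_{[γ]}` = `OneMorphism.pathIso`, and `CompatibleWith.pathIso_eq_pathIso`: the datum of a
compatibility witness IS `Φ_{[γ]}`), `DiagramMorphismsIsomorphic.lean` (abc-iut-f-095:
`Isomorphic.symm`) and `DiagramMorphismsAutGroup.lean` (abc-iut-f-095: `TwoMorphism.naturality_app`,
`Aut.mk_eq_mk`).  The printed verification, carried out:

* `TwoMorphism.naturality_pathIso_app` / `naturality_pathIso` — a 2-morphism `Θ : Φ → Ψ` commutes
  with the path isomorphisms: `𝒟'_{Φ_Γ⃗[γ]}(Θ_{v₁}) ≫ Ψ_{[γ]} = Φ_{[γ]} ≫ Θ_{v₂} 𝒟_{[γ]}` (induction on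
  `[γ]`, the edge case being the defining compatibility of `Θ` with the `Φ_e`, `Ψ_e`);
* `OneMorphism.CompatibleWith.nonempty_of_twoIso` / `OneMorphism.Isomorphic.nonempty_compatibleWith_iff`
  — if `Φ` is compatible with `ℋ`, `ℋ'` and `Θ : Φ ⥲ Ψ` is a 2-isomorphism, then `Ψ` is compatible with
  `ℋ`, `ℋ'` (same bijection of boundary sets; the commuting squares for `Ψ` follow from those for `Φ`
  by conjugating with `Θ`, using the naturality of `ζ'_{Φϖ}` and of `Θ_{v₂}`);
* `SelfEquivalence.nonempty_compatibleWith_iff_of_mk_eq` — hence "compatible with `ℋ`, `ℋ'`" is a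
  property of the CLASS `[Φ] ∈ Aut(𝒟)` of a self-equivalence (the form used in Def 3.5 (vi) /
  Cor 5.5 (v): nexus-CLASSES of self-equivalences compatible with families of homotopies).

abc-iut cell, seat abc-iut-f-095 (gen 3; by-name completion of the Def 3.5 (v) lineage; no binder
of any certificate changes).  Pure category theory; nothing here bears on the disputed [IUTchIII]
Cor. 3.12 or takes a side; typed ≠ proved elsewhere.
-/

namespace Literature.AnabelianGeometry.AbsoluteAnabelian

open _root_.CategoryTheory _root_.Quiver

universe v u w

namespace DiagramOfCategories

variable {V : Type w} [Quiver.{v} V] {V' : Type w} [Quiver.{v} V']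
  {F : V ⥤q V'} {D : DiagramOfCategories.{v, u, w} V} {D' : DiagramOfCategories.{v, u, w} V'}

/-! ### Two bookkeeping lemmas over variable functors

The path functors `𝒟_{[]}`, `𝒟_{[γ·e]}` are equal to `𝟭`, `𝒟_{[γ]} ⋙ 𝒟_e` only propositionally
(`pathFunctor_nil`, `pathFunctor_cons`), and `Φ_{[γ]}` is pinned through `eqToIso`s along these
equalities (`OneMorphism.pathIso_nil/_cons`).  The two steps of the induction below are therefore
first proved over VARIABLE functors `P = 𝟭`, `P = P₁ ⋙ P₂` (where `subst` applies and the `eqToIso`s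
become identities), then instantiated. -/

section Aux

variable {A : Type u} [Category.{v} A] {B : Type u} [Category.{v} B] {C : Type u} [Category.{v} C]
  {A' : Type u} [Category.{v} A'] {B' : Type u} [Category.{v} B'] {C' : Type u} [Category.{v} C']

/-- Step `[]` of `TwoMorphism.naturality_pathIso_app`, over variable functors `P = 𝟭`, `P' = 𝟭` and
isomorphisms pinned as in `OneMorphism.CompatibleWith.pathIso_nil`. [cite: MochizukiAbsTopIII2015, Definition 3.5 (v) p.76] -/
theorem TwoMorphism.naturality_pathIso_app_nil_aux {Φa Ψa : A ⥤ A'} (θa : Φa ⟶ Ψa)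
    {P : A ⥤ A} {P' : A' ⥤ A'} (hP : P = 𝟭 A) (hP' : P' = 𝟭 A')
    {ιΦ : Φa ⋙ P' ≅ P ⋙ Φa} {h₁ : Φa ⋙ P' = Φa ⋙ 𝟭 A'} {h₂ : 𝟭 A ⋙ Φa = P ⋙ Φa}
    (hιΦ : ιΦ = eqToIso h₁ ≪≫ (Φa.rightUnitor ≪≫ Φa.leftUnitor.symm) ≪≫ eqToIso h₂)
    {ιΨ : Ψa ⋙ P' ≅ P ⋙ Ψa} {h₃ : Ψa ⋙ P' = Ψa ⋙ 𝟭 A'} {h₄ : 𝟭 A ⋙ Ψa = P ⋙ Ψa}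
    (hιΨ : ιΨ = eqToIso h₃ ≪≫ (Ψa.rightUnitor ≪≫ Ψa.leftUnitor.symm) ≪≫ eqToIso h₄) (x : A) :
    P'.map (θa.app x) ≫ ιΨ.hom.app x = ιΦ.hom.app x ≫ θa.app (P.obj x) := by
  subst hP hP' hιΦ hιΨ
  simp only [eqToIso_refl, Iso.refl_trans, Iso.trans_refl]
  -- all structure 2-cells are identities; restate with coherent objects
  change θa.app x ≫ (𝟙 _ ≫ 𝟙 _) = (𝟙 _ ≫ 𝟙 _) ≫ θa.app x
  simp only [Category.comp_id, Category.id_comp]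

/-- Step `[γ] ↦ [γ·e]` of `TwoMorphism.naturality_pathIso_app`, over variable functors
`P = P₁ ⋙ P₂`, `P' = P'₁ ⋙ P'₂` and isomorphisms pinned as in `OneMorphism.CompatibleWith.pathIso_cons`.
[cite: MochizukiAbsTopIII2015, Definition 3.5 (v) p.76] -/
theorem TwoMorphism.naturality_pathIso_app_cons_aux {Φa Ψa : A ⥤ A'} {Φb Ψb : B ⥤ B'}
    {Φc Ψc : C ⥤ C'} (θa : Φa ⟶ Ψa) (θb : Φb ⟶ Ψb) (θc : Φc ⟶ Ψc)
    {P₁ : A ⥤ B} {P₂ : B ⥤ C} {P : A ⥤ C} {P'₁ : A' ⥤ B'} {P'₂ : B' ⥤ C'} {P' : A' ⥤ C'}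
    (hP : P = P₁ ⋙ P₂) (hP' : P' = P'₁ ⋙ P'₂)
    {ι₁Φ : Φa ⋙ P'₁ ≅ P₁ ⋙ Φb} {ι₁Ψ : Ψa ⋙ P'₁ ≅ P₁ ⋙ Ψb}
    {ι₂Φ : Φb ⋙ P'₂ ≅ P₂ ⋙ Φc} {ι₂Ψ : Ψb ⋙ P'₂ ≅ P₂ ⋙ Ψc}
    {ιΦ : Φa ⋙ P' ≅ P ⋙ Φc} {h₁ : Φa ⋙ P' = Φa ⋙ (P'₁ ⋙ P'₂)} {h₂ : (P₁ ⋙ P₂) ⋙ Φc = P ⋙ Φc}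
    (hιΦ : ιΦ = eqToIso h₁ ≪≫ ((Functor.associator _ _ _).symm ≪≫
      Functor.isoWhiskerRight ι₁Φ P'₂ ≪≫ Functor.associator _ _ _ ≪≫
      Functor.isoWhiskerLeft P₁ ι₂Φ ≪≫ (Functor.associator _ _ _).symm) ≪≫ eqToIso h₂)
    {ιΨ : Ψa ⋙ P' ≅ P ⋙ Ψc} {h₃ : Ψa ⋙ P' = Ψa ⋙ (P'₁ ⋙ P'₂)} {h₄ : (P₁ ⋙ P₂) ⋙ Ψc = P ⋙ Ψc}
    (hιΨ : ιΨ = eqToIso h₃ ≪≫ ((Functor.associator _ _ _).symm ≪≫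
      Functor.isoWhiskerRight ι₁Ψ P'₂ ≪≫ Functor.associator _ _ _ ≪≫
      Functor.isoWhiskerLeft P₁ ι₂Ψ ≪≫ (Functor.associator _ _ _).symm) ≪≫ eqToIso h₄)
    (ih : ∀ x : A, P'₁.map (θa.app x) ≫ ι₁Ψ.hom.app x = ι₁Φ.hom.app x ≫ θb.app (P₁.obj x))
    (he : ∀ y : B, P'₂.map (θb.app y) ≫ ι₂Ψ.hom.app y = ι₂Φ.hom.app y ≫ θc.app (P₂.obj y))
    (x : A) : P'.map (θa.app x) ≫ ιΨ.hom.app x = ιΦ.hom.app x ≫ θc.app (P.obj x) := by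
  subst hP hP' hιΦ hιΨ
  simp only [eqToIso_refl, Iso.refl_trans, Iso.trans_refl]
  -- associators are identities, whiskerings act componentwise; restate with coherent objects
  change P'₂.map (P'₁.map (θa.app x)) ≫
      (𝟙 _ ≫ (P'₂.map (ι₁Ψ.hom.app x) ≫ (𝟙 _ ≫ (ι₂Ψ.hom.app (P₁.obj x) ≫ 𝟙 _)))) =
    (𝟙 _ ≫ (P'₂.map (ι₁Φ.hom.app x) ≫ (𝟙 _ ≫ (ι₂Φ.hom.app (P₁.obj x) ≫ 𝟙 _)))) ≫
      θc.app (P₂.obj (P₁.obj x))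
  simp only [Category.id_comp, Category.comp_id, Category.assoc]
  erw [← Functor.map_comp_assoc, ih x, Functor.map_comp_assoc, he]
  rfl

end Aux

/-! ### 2-morphisms commute with the path isomorphisms `Φ_{[γ]}` -/

/-- **A 2-morphism `Θ : Φ → Ψ` is compatible with the path isomorphisms**, componentwise:
`𝒟'_{Φ_Γ⃗[γ]}((Θ_{v₁})_x) ≫ (Ψ_{[γ]})_x = (Φ_{[γ]})_x ≫ (Θ_{v₂})_{𝒟_{[γ]} x}` — by induction on the path,
the edge step being the defining condition `Ψ_e ∘ (𝒟'_{Φe} ∘ Θ_{v₁}) = (Θ_{v₂} ∘ 𝒟_e) ∘ Φ_e` of a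
2-morphism. [cite: MochizukiAbsTopIII2015, Definition 3.5 (v) p.76] -/
theorem TwoMorphism.naturality_pathIso_app {Φ Ψ : OneMorphism F D D'} (Θ : TwoMorphism Φ Ψ)
    {a : V} : ∀ {b : V} (p : Path a b) (x : D.obj a),
      (D'.pathFunctor (F.mapPath p)).map ((Θ.app a).app x) ≫ (Ψ.pathIso p).hom.app x =
        (Φ.pathIso p).hom.app x ≫ (Θ.app b).app ((D.pathFunctor p).obj x)
  | _, .nil, x =>
    TwoMorphism.naturality_pathIso_app_nil_aux (Θ.app a) (pathFunctor_nil D a)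
      (by rw [Prefunctor.mapPath_nil, pathFunctor_nil]) (Φ.pathIso_nil a) (Ψ.pathIso_nil a) x
  | _, .cons p e, x =>
    TwoMorphism.naturality_pathIso_app_cons_aux (Θ.app a) (Θ.app _) (Θ.app _)
      (pathFunctor_cons D p e) (by rw [Prefunctor.mapPath_cons, pathFunctor_cons])
      (Φ.pathIso_cons p e) (Ψ.pathIso_cons p e)
      (fun y => TwoMorphism.naturality_pathIso_app Θ p y) (fun y => Θ.naturality_app e y) x

/-- The same compatibility as an identity of natural transformations:
`(Θ_{v₁} ▹ 𝒟'_{Φ_Γ⃗[γ]}) ≫ Ψ_{[γ]} = Φ_{[γ]} ≫ (𝒟_{[γ]} ◃ Θ_{v₂})`.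
[cite: MochizukiAbsTopIII2015, Definition 3.5 (v) p.76] -/
theorem TwoMorphism.naturality_pathIso {Φ Ψ : OneMorphism F D D'} (Θ : TwoMorphism Φ Ψ)
    {a b : V} (p : Path a b) :
    Functor.whiskerRight (Θ.app a) (D'.pathFunctor (F.mapPath p)) ≫ (Ψ.pathIso p).hom =
      (Φ.pathIso p).hom ≫ Functor.whiskerLeft (D.pathFunctor p) (Θ.app b) := by
  ext x
  simp only [NatTrans.comp_app, Functor.whiskerRight_app, Functor.whiskerLeft_app]
  exact Θ.naturality_pathIso_app p x

/-! ### Compatibility with families of homotopies is stable under 2-isomorphism -/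

/-- **Def 3.5 (v) p.76: "if `Φ` is compatible with `ℋ`, `ℋ'`, then so is any equivalence `Ψ` that
is isomorphic to `Φ`"** — transport of a compatibility witness along a 2-isomorphism `Θ : Φ ⥲ Ψ`:
the bijection of boundary sets is that of `Φ` (same `Φ_Γ⃗`), the path isomorphisms are the `Ψ_{[γ]}`,
and each commuting square for `Ψ` is the square for `Φ` conjugated by `Θ` (naturality of `ζ'_{Φ_Γ⃗ϖ}`
in `Θ_{v₁}`, of `Θ` along paths, and of `Θ_{v₂}` in `ζ_ϖ`).
[cite: MochizukiAbsTopIII2015, Definition 3.5 (v) p.76] -/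
theorem OneMorphism.CompatibleWith.nonempty_of_twoIso {Φ Ψ : OneMorphism F D D'}
    {H : D.HomotopyFamily} {H' : D'.HomotopyFamily} (c : Φ.CompatibleWith H H')
    (Θ : TwoMorphism Φ Ψ) (hΘ : Θ.IsIso) : Nonempty (Ψ.CompatibleWith H H') := by
  haveI : ∀ a, IsIso (Θ.app a) := hΘ
  refine ⟨{ pathIso := fun p => Ψ.pathIso p
            pathIso_nil := fun a => Ψ.pathIso_nil a
            pathIso_cons := fun p e => Ψ.pathIso_cons p e
            boundary_iff := c.boundary_iff
            boundary_surj := c.boundary_surj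
            η_compat := fun {a b} p q h => ?_ }⟩
  ext x
  have hc := NatTrans.congr_app (c.η_compat p q h) x
  simp only [NatTrans.comp_app, Functor.whiskerLeft_app, Functor.whiskerRight_app,
    c.pathIso_eq_pathIso] at hc
  have Np := Θ.naturality_pathIso_app p x
  have Nq := Θ.naturality_pathIso_app q x
  simp only [NatTrans.comp_app, Functor.whiskerLeft_app, Functor.whiskerRight_app]
  refine (cancel_epi ((D'.pathFunctor (F.mapPath p)).map ((Θ.app a).app x))).1 ?_
  erw [reassoc_of% Np, (H'.η ((c.boundary_iff p q).mp h)).naturality_assoc ((Θ.app a).app x), Nq,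
    reassoc_of% hc, (Θ.app b).naturality ((H.η h).app x)]
  exact (Category.assoc _ _ _).symm

/-- **Compatibility with `ℋ`, `ℋ'` depends only on the 2-isomorphism class of the 1-morphism.**
[cite: MochizukiAbsTopIII2015, Definition 3.5 (v) p.76] -/
theorem OneMorphism.Isomorphic.nonempty_compatibleWith_iff {Φ Ψ : OneMorphism F D D'}
    (h : Φ.Isomorphic Ψ) (H : D.HomotopyFamily) (H' : D'.HomotopyFamily) :
    Nonempty (Φ.CompatibleWith H H') ↔ Nonempty (Ψ.CompatibleWith H H') := by
  constructor
  · rintro ⟨c⟩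
    obtain ⟨Θ, hΘ⟩ := h
    exact c.nonempty_of_twoIso Θ hΘ
  · rintro ⟨c⟩
    obtain ⟨Θ, hΘ⟩ := h.symm
    exact c.nonempty_of_twoIso Θ hΘ

/-- The same over a propositional equality of morphisms of graphs (`OneMorphism.IsoOver`, the shape
of `SelfEquivalence.Isomorphic`): compatibility is invariant under 2-isomorphism over `E = E'`.
[cite: MochizukiAbsTopIII2015, Definition 3.5 (v) p.76] -/
theorem OneMorphism.IsoOver.nonempty_compatibleWith_iff {E E' : V ⥤q V'} {Φ : OneMorphism E D D'}
    {Ψ : OneMorphism E' D D'} (h : Φ.IsoOver Ψ) (H : D.HomotopyFamily) (H' : D'.HomotopyFamily) :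
    Nonempty (Φ.CompatibleWith H H') ↔ Nonempty (Ψ.CompatibleWith H H') := by
  obtain ⟨hE, hiso⟩ := h
  subst hE
  exact hiso.nonempty_compatibleWith_iff H H'

/-- **Compatibility with families of homotopies is a property of the class `[Φ] ∈ Aut(𝒟)`** of a
self-equivalence (Def 3.5 (v): `Aut(𝒟)` = isomorphism classes of self-equivalences; used for the
nexus-classes of Def 3.5 (vi)). [cite: MochizukiAbsTopIII2015, Definition 3.5 (v) pp.76–77] -/
theorem SelfEquivalence.nonempty_compatibleWith_iff_of_mk_eq {Φ Ψ : D.SelfEquivalence}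
    (h : Aut.mk Φ = Aut.mk Ψ) (H H' : D.HomotopyFamily) :
    Nonempty (Φ.hom.CompatibleWith H H') ↔ Nonempty (Ψ.hom.CompatibleWith H H') :=
  OneMorphism.IsoOver.nonempty_compatibleWith_iff
    (SelfEquivalence.isomorphic_iff_isoOver.mp (Aut.mk_eq_mk.mp h)) H H'

end DiagramOfCategories

end Literature.AnabelianGeometry.AbsoluteAnabelian
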